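import Summits.BirchSwinnertonDyer.BirchSwinnertonDyer.Theses.LeadingTerm
import Summits.BirchSwinnertonDyer.BirchSwinnertonDyer.Theses.Squeeze
import Summits.BirchSwinnertonDyer.BirchSwinnertonDyer.Theorems.LeadingTermSqueezeUBR2Cells
import Literature.NumberTheory.EllipticCurves.KatoRankBound
import Literature.NumberTheory.EllipticCurves.LeadingTerm
import Literature.NumberTheory.EllipticCurves.BSDHeegnerPoints
import HarnessLib

/-!
# Crux-strategist sketch — crux `SqueezeUB` / `SqueezeUBR2` (stmt-BirchSwinnertonDyer-0145)

Typed artefacts behind `STRATEGY-CENSUS.md` (planner-cstrat-stmt-BirchSwinnertonDyer-0145-s1-0,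
2026-08-17). Nothing here is a new line; every theorem is bookkeeping over LANDED tree theorems
(`Theorems/LeadingTermSqueezeUBR2Cells.lean`, p131767) and named facts taken as hypotheses.

* §D  Decomposition candidates: D1 cells `GZKCell ∧ ParityMW ∧ UB4 → SqueezeUBR2` (glue proved
      from landed theorems; `ParityMW` is verbatim `Squeeze.SqueezeParity`, stmt-0146), the
      cell-by-analytic-rank form of `UB4`, D3 the sector split.
* §S  Strengthenings S1 (`corank Sel_{p^∞} ≤ r_an` at every `p` = crux + a bound on `corank Ш`),
      S2 (one-prime Selmer cap on the `rank ≥ 4` cell), S3 (the quadratic-base-change form).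
* §T  Transfer T1: Tate's Frobenius-eigenspace step transferred along the cyclotomic tower is
      Kato's bound; the residual link is `WCL4` (∃ odd good ordinary `p`, `ord_T L_p ≤ r_an`),
      a weakening of PAdicOrderV2's stmt-0489; composition to `UB4` proved.
* §N  Negation ladder: the obstructions to an excess-rank curve at ranks 1, 2, 3 are exactly
      `GZKCell` (+ `ParityMW` at rank 3); the first unobstructed stage is `(rank, r_an) = (4, 2)`.
-/

set_option linter.dupNamespace false

namespace Summit.BirchSwinnertonDyer.BirchSwinnertonDyer.Cruxes.SqueezeUB.Strategist

open scoped MatrixGroups ModularForm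
open CongruenceSubgroup Literature.NumberTheory.EllipticCurves
  Literature.NumberTheory.EllipticCurves.ModularForms WeierstrassCurve
open Summit.BirchSwinnertonDyer.BirchSwinnertonDyer.Theses.Squeeze (SqueezeUB SqueezeParity)
open Summit.BirchSwinnertonDyer.BirchSwinnertonDyer.Theses.LeadingTerm (SqueezeUBR2)
open Summit.BirchSwinnertonDyer.BirchSwinnertonDyer.Theorems

/-! ## §D Decomposition -/

/-- D1, child 1 (literature debt): the `≤` half of Gross–Zagier–Kolyvagin on globally minimal
models. [cite: Darmon2004, Thm. 3.22] -/
def GZKCell : Prop :=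
  ∀ (W : WeierstrassCurve ℚ) [W.IsElliptic] [W.IsGloballyMinimal],
    W.analyticRank ≤ 1 → W.mordellWeilRank ≤ W.analyticRank

/-- D1, child 2: Mordell–Weil parity — VERBATIM route Squeeze's crux `SqueezeParity` (stmt-0146),
so that filing it would attach to the existing item, not create a new one. [folklore] -/
def ParityMW : Prop :=
  ∀ (W : WeierstrassCurve ℚ) [W.IsElliptic], Even W.mordellWeilRank ↔ Even W.analyticRank

/-- D1, child 3 (the open core): no excess rank above four independent points. [folklore] -/
def UB4 : Prop :=
  ∀ (W : WeierstrassCurve ℚ) [W.IsElliptic] [W.IsGloballyMinimal],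
    4 ≤ W.mordellWeilRank → 2 ≤ W.analyticRank → W.mordellWeilRank ≤ W.analyticRank

/-- `ParityMW` IS `SqueezeParity` (dedup by signature). [folklore] -/
theorem parityMW_iff_squeezeParity : ParityMW ↔ SqueezeParity := Iff.rfl

/-- **D1 glue** `GZKCell → ParityMW → UB4 → SqueezeUBR2`, from the landed
`squeezeUBR2_iff_cells` and the parity ratchet `squeezeUB_ub3_of_parity_of_ub4` (p131767).
Sorry-free; this is what a `route edit --split SqueezeUBR2 --into GZKCell ParityMW UB4` would
carry as `--glue`. [folklore] -/
theorem squeezeUBR2_of_subs : GZKCell → ParityMW → UB4 → SqueezeUBR2 :=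
  fun hG hP hU =>
    squeezeUBR2_iff_cells.mpr ⟨hG, squeezeUB_ub3_of_parity_of_ub4 (fun W _ _ => hP W) hU⟩

/-- Converse bookkeeping: the crux gives back `GZKCell ∧ UB4` (restriction); it does NOT give
`ParityMW` (parity is extra input: in route LeadingTerm it comes from `PinchPrime` + Kato 18.4 +
`p`-parity, landed `squeezeUB_parity_of_pinchPrime`, p131867). [folklore] -/
theorem gzkCell_and_ub4_of_squeezeUBR2 (h : SqueezeUBR2) : GZKCell ∧ UB4 :=
  ⟨fun W _ _ _ => h W, fun W _ _ _ _ => h W⟩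

/-- `GZKCell` is the `≤` half of the Literature fact bsd.S17
`rank_eq_analyticRank_of_analyticRank_le_one` (Gross–Zagier 1986 + Kolyvagin 1990; unproved in
tree). CONDITIONAL on that fact. [cite: Darmon2004, Thm. 3.22] -/
theorem gzkCell_of_fact (h : rank_eq_analyticRank_of_analyticRank_le_one) : GZKCell :=
  fun W _ _ h1 => (h W h1).1.le

/-- D1′: the open core cut by analytic rank — "no curve with `r_an = m` has `max(4, m+1)` or more
independent points". [folklore] -/
def NoExcessAt (m : ℕ) : Prop :=
  ∀ (W : WeierstrassCurve ℚ) [W.IsElliptic] [W.IsGloballyMinimal],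
    W.analyticRank = m → 4 ≤ W.mordellWeilRank → W.mordellWeilRank ≤ m

/-- `UB4 ↔ ∀ m ≥ 2, NoExcessAt m`; the first cell is `m = 2` ("four independent points and
`w = +1` force `L''(E,1) = 0`"). No cell is known to be easier than another. [folklore] -/
theorem ub4_iff_forall_noExcessAt : UB4 ↔ ∀ m, 2 ≤ m → NoExcessAt m := by
  constructor
  · intro h m hm W _ _ hW h4
    have := h W h4 (by omega)
    omega
  · intro h W _ _ h4 h2
    exact h _ h2 W rfl h4

/-- D3 (sector split, card `unbalanced-definite-theta-cap`): the `rank ≥ 4` cell on curves WITH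
a prime of multiplicative reduction … -/
def UB4Mult : Prop :=
  ∀ (W : WeierstrassCurve ℚ) [W.IsElliptic] [W.IsGloballyMinimal],
    (∃ (p : ℕ) (_ : Fact p.Prime), W.HasMultiplicativeReductionAtPrime p) →
      4 ≤ W.mordellWeilRank → 2 ≤ W.analyticRank → W.mordellWeilRank ≤ W.analyticRank

/-- … and on curves with potentially good reduction everywhere (integral `j`; contains all CM
curves). [folklore] -/
def UB4PotGood : Prop :=
  ∀ (W : WeierstrassCurve ℚ) [W.IsElliptic] [W.IsGloballyMinimal],
    (∀ (p : ℕ) (_ : Fact p.Prime), ¬ W.HasMultiplicativeReductionAtPrime p) →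
      4 ≤ W.mordellWeilRank → 2 ≤ W.analyticRank → W.mordellWeilRank ≤ W.analyticRank

/-- D3 glue (trivial case split). Both halves keep the full difficulty (census §Decomposition).
[folklore] -/
theorem ub4_of_sectors (hM : UB4Mult) (hG : UB4PotGood) : UB4 := by
  intro W _ _ h4 h2
  by_cases h : ∃ (p : ℕ) (_ : Fact p.Prime), W.HasMultiplicativeReductionAtPrime p
  · exact hM W h h4 h2
  · push Not at h
    exact hG W (fun p hp => h p hp) h4 h2

/-! ## §S Strengthenings -/

/-- S1: the Selmer corank never exceeds the analytic rank, at EVERY prime. [folklore] -/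
def CorankUBAll : Prop :=
  ∀ (W : WeierstrassCurve ℚ) [W.IsElliptic] (p : ℕ) [Fact p.Prime], W.selmerCorank p ≤ W.analyticRank

/-- S1 ⟹ crux (take `p = 2`; `rank ≤ corank Sel_{p^∞}` is the proved corank identity).
[folklore] -/
theorem squeezeUBR2_of_corankUBAll (h : CorankUBAll) : SqueezeUBR2 := by
  intro W _
  haveI : Fact (Nat.Prime 2) := ⟨Nat.prime_two⟩
  exact (mordellWeilRank_le_selmerCorank W 2).trans (h W 2)

/-- What S1 adds to the crux, exactly: `S1 ↔ ∀ W p, rank + corank Ш[p^∞] ≤ r_an` (corank identity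
`selmerCorank = rank + shaCorank`, a tree THEOREM). So S1 = crux + a bound on `corank_ℤₚ Ш[p^∞]`
at every `p` — under the crux with equality (BSD) it says `Ш[p^∞]` has corank 0 for all `p`,
i.e. it costs `ShaFiniteConjecture`-strength input on top (census §Strengthen, S1). [folklore] -/
theorem corankUBAll_iff :
    CorankUBAll ↔ ∀ (W : WeierstrassCurve ℚ) [W.IsElliptic] (p : ℕ) [Fact p.Prime],
      W.mordellWeilRank + W.shaCorank p ≤ W.analyticRank := by
  constructor
  · intro h W _ p _
    have := h W p
    rw [W.selmerCorank_eq_mordellWeilRank_add_holds p] at this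
    exact this
  · intro h W _ p _
    rw [W.selmerCorank_eq_mordellWeilRank_add_holds p]
    exact h W p

/-- S2: ONE prime with `corank_ℤₚ Sel_{p^∞} ≤ r_an`, on the `rank ≥ 4`, `r_an ≥ 2` cell (the
one-prime Selmer cap = route ToricShedding's thesis shape; junction p131543). [folklore] -/
def OnePrimeSelmerUB4 : Prop :=
  ∀ (W : WeierstrassCurve ℚ) [W.IsElliptic] [W.IsGloballyMinimal],
    4 ≤ W.mordellWeilRank → 2 ≤ W.analyticRank →
      ∃ (p : ℕ) (_ : Fact p.Prime), W.selmerCorank p ≤ W.analyticRank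

/-- S2 ⟹ UB4 (corank identity). [folklore] -/
theorem ub4_of_onePrimeSelmerUB4 (h : OnePrimeSelmerUB4) : UB4 := by
  intro W _ _ h4 h2
  obtain ⟨p, hp, hle⟩ := h W h4 h2
  exact (mordellWeilRank_le_selmerCorank W p).trans hle

/-- S3 (the shape in which the solved case was solved): UB over an imaginary quadratic field,
`rank E(ℚ) + rank E^{(d_K)}(ℚ) ≤ ord_{s=1} L(E,s)L(E^{(d_K)},s)`; Kolyvagin's theorem is the case
`ord = 1`. First open case `ord_{s=1} L(E/K,s) = 3` (`w(E/K) = −1`). Typed only; equivalent to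
the crux modulo `analyticRankEK_eq_add`, a non-vanishing-twist fact and Kato for the twist
(census §Strengthen, S3). [cite: GrossZagier1986, I.§7] -/
def QuadraticFieldUB : Prop :=
  ∀ (W : WeierstrassCurve ℚ) [W.IsElliptic] (K : Type) [Field K] [NumberField K],
    IsImaginaryQuadratic K →
      W.mordellWeilRank + (W.quadraticTwist (NumberField.discr K : ℚ)).mordellWeilRank ≤
        analyticRankEK W K

/-! ## §T Transfer T1 — Tate's step along the cyclotomic tower = Kato; the residual link -/

/-- T1 residual: at ONE odd good ordinary prime the cyclotomic characteristic order does not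
exceed the complex order, on the `rank ≥ 4`, `r_an ≥ 2` cell (the `∃p`/`≤` weakening of
PAdicOrderV2's crux stmt-0489; v1 stub WCL of the lead's line). [cite: Kato2004, Thm 18.4] -/
def WCL4 : Prop :=
  ∀ (W : WeierstrassCurve ℚ) [W.IsElliptic] [W.IsGloballyMinimal]
    {N : ℕ} [NeZero N] (f : CuspForm (Gamma0 N) 2), IsNewformOf W f →
      4 ≤ W.mordellWeilRank → 2 ≤ W.analyticRank →
      ∃ (p : ℕ) (_ : Fact p.Prime), p ≠ 2 ∧ IsOrdinaryAt W p ∧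
        (padicLFunction f (unitRoot W p : ℚ_[p])).order ≤ (W.analyticRank : ℕ∞)

/-- **T1 composition**: Kato's corank bound (Tate's "Frobenius-fixed ≤ multiplicity" step with
`Γ = Gal(ℚ_∞/ℚ)` in place of Frobenius; named fact, ∀-closed hypothesis) + modularity + `WCL4`
give `OnePrimeSelmerUB4`, hence `UB4`. So the transferred argument leaves exactly `WCL4`.
CONDITIONAL on the Kato fact and modularity. [cite: Kato2004, Thm 18.4] -/
theorem onePrimeSelmerUB4_of_katoHalf
    (hK : ∀ (W : WeierstrassCurve ℚ) [W.IsElliptic] [W.IsGloballyMinimal] (p : ℕ) [Fact p.Prime]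
      {N : ℕ} [NeZero N] {f : CuspForm (Gamma0 N) 2},
      kato_selmerCorank_le_order_padicLFunction W p (f := f))
    (hM : ∀ (W : WeierstrassCurve ℚ) [W.IsElliptic] [W.IsGloballyMinimal],
      ∃ (N : ℕ) (_ : NeZero N) (f : CuspForm (Gamma0 N) 2), IsNewformOf W f)
    (hW : WCL4) : OnePrimeSelmerUB4 := by
  intro W _ _ h4 h2
  obtain ⟨N, hN, f, hf⟩ := hM W
  obtain ⟨p, hp, hp2, hord, hle⟩ := hW W f hf h4 h2
  have h1 : (W.selmerCorank p : ℕ∞) ≤ W.analyticRank := (hK W p hp2 hord hf).trans hle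
  exact ⟨p, hp, by exact_mod_cast h1⟩

theorem ub4_of_katoHalf
    (hK : ∀ (W : WeierstrassCurve ℚ) [W.IsElliptic] [W.IsGloballyMinimal] (p : ℕ) [Fact p.Prime]
      {N : ℕ} [NeZero N] {f : CuspForm (Gamma0 N) 2},
      kato_selmerCorank_le_order_padicLFunction W p (f := f))
    (hM : ∀ (W : WeierstrassCurve ℚ) [W.IsElliptic] [W.IsGloballyMinimal],
      ∃ (N : ℕ) (_ : NeZero N) (f : CuspForm (Gamma0 N) 2), IsNewformOf W f)
    (hW : WCL4) : UB4 :=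
  ub4_of_onePrimeSelmerUB4 (onePrimeSelmerUB4_of_katoHalf hK hM hW)

/-! ## §N Negation ladder — where the counterexample construction is obstructed -/

/-- Stage 1: one point of infinite order forces `L(E,1) = 0` (Kato 14.2 / GZK cell at `r_an = 0`).
[cite: Kato2004, Thm 14.2] -/
theorem noCex_rank_one (hG : GZKCell) :
    ∀ (W : WeierstrassCurve ℚ) [W.IsElliptic] [W.IsGloballyMinimal],
      1 ≤ W.mordellWeilRank → 1 ≤ W.analyticRank := by
  intro W _ _ h1
  by_contra h
  have := hG W (by omega)
  omega

/-- Stage 2: two independent points force `L(E,1) = L'(E,1) = 0` (GZK cell at `r_an ≤ 1`).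
[cite: Darmon2004, Thm. 3.22] -/
theorem noCex_rank_two (hG : GZKCell) :
    ∀ (W : WeierstrassCurve ℚ) [W.IsElliptic] [W.IsGloballyMinimal],
      2 ≤ W.mordellWeilRank → 2 ≤ W.analyticRank := by
  intro W _ _ h2
  by_contra h
  have := hG W (by omega)
  omega

/-- Stage 3: EXACTLY three independent points force `ord ≥ 3`, given Mordell–Weil parity (the
cell `(3, 2)` is parity-forbidden). Note the statement is about `rank = 3`, not `rank ≥ 3`:
`(4, 2)` is parity-consistent — the first unobstructed stage. [folklore] -/
theorem noCex_rank_three (hG : GZKCell) (hP : ParityMW) :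
    ∀ (W : WeierstrassCurve ℚ) [W.IsElliptic] [W.IsGloballyMinimal],
      W.mordellWeilRank = 3 → 3 ≤ W.analyticRank := by
  intro W _ _ h3
  have h2 := noCex_rank_two hG W (by omega)
  by_contra h
  have ha : W.analyticRank = 2 := by omega
  have hp := hP W
  rw [h3, ha] at hp
  exact absurd (hp.mpr ⟨1, rfl⟩) (by decide)

/-- Stage 4, the unobstructed one, typed: "no globally minimal elliptic curve has four or more
independent rational points and analytic rank exactly 2". This IS the first cell of `UB4`
(`NoExcessAt 2`); no lemma short of it is known (census §Negation). [folklore] -/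
theorem firstOpenCell_iff : NoExcessAt 2 ↔
    ∀ (W : WeierstrassCurve ℚ) [W.IsElliptic] [W.IsGloballyMinimal],
      4 ≤ W.mordellWeilRank → W.analyticRank ≠ 2 := by
  constructor
  · intro h W _ _ h4 h2
    have := h W h2 h4
    omega
  · intro h W _ _ h2 h4
    exact absurd h2 (h W h4)

end Summit.BirchSwinnertonDyer.BirchSwinnertonDyer.Cruxes.SqueezeUB.Strategist
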